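import Mathlib
import HarnessLib
import Summits.HubbardSuperconductivity.HubbardSuperconductivity.Theorems.KLProgrammeKLRegimeSplitTwoLegSizesMSFitPiecesBase

/-!
# Route `KLProgramme`, crux K3 — ENGINE child (stmt-…-19918 → gen-6 engine child, `stub_twoLeg_step` / `stub_twoLeg_scale0`,
# clause (E3a-MS)): THE FITS ON THE TREE'S OBJECTS — `msPieceSlotL … m j ≤ msBarQ … · pieceSize R U m j` and
# `msPieceBaseL … j ≤ twoLegBar G Q U j n₀` from the package requirements `msReqSlot` / `msReqBase0` / `msReqBase1`

Cell `gate-hubbard-kl`, seat hubbard-kl-k3c3-p3 (g4); MS-A34 / MS-A0 / MS-A34-ter.  These are the `hfit_n` / `hfit_m` inputs of k3c3-p1's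
Λ-parametric suppliers (`twoLegSizesMSWith_succ/zero_of_pieces_L`, `…MSQ`) at Jackson degree `d = 4^{n₀}`, orders `j = 0 … 4`, discharged from:
the regime (`0 < U ≤ 1`, `1 ≤ n₀ < m`, chain regime `msA ≤ 1/20`, `klCurveD ≤ msDt − 2·msA`), the low-part totals in mixed-bound shape
(`Λ₃ ≤ λ₃Gfr₁U²4^{n₀}`, `Λ₄ ≤ λ₄Gfr₁U²16^{n₀}`), the ENGINE's increment-symbol profile at the chain frames
(`σ k l ≤ μ_l·U²·4^{(l−2)(n₀−1)}`, written out per `l`), its one-piece response profile (`ε m l ≤ ν_l·U²·4^{−n₀}·pieceSize R U m l`, written out),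
and ONE package inequality per order (`msReqSlot … j ≤ Q.CE·G.S 1·R.Gfr j`, resp. `msReqBase0 … j ≤ G.S j/2` and `U·msReqBase1 … j ≤ G.S j/2`).
THIS FILE: the ALL-ORDERS forms `msPieceSlotL_le` / `msPieceBaseL_le` (`∀ j ≤ 4`) = the literal `hfit_m` / `hfit_n` inputs of the Λ-parametric suppliers at `d = 4^{n₀}`.  Everything PROVED; no definitions, no named facts. [folklore]
-/

noncomputable section

namespace Summit.HubbardSuperconductivity.HubbardSuperconductivity.Theorems.KLRegimeSplit

set_option linter.dupNamespace false -- summit = problem name (single-conjunct summit), D-0017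

open Real Finset Summit.HubbardSuperconductivity.HubbardSuperconductivity.Theorems.PerturbedFermiCurve

set_option maxRecDepth 8000 in
/-- **(E3a-MS) SLOT FITS ON THE TREE, all orders `j ≤ 4`** — the literal `hfit_m` input of `twoLegSizesMSTQ_succ_of_pieces` (Λ-parametric, `d = 4^{n₀}`)
for one slot `m`, from the regime, the Λ-shapes, the engine profiles written out for `l ≤ 5`, and the package inequalities
`∀ j ≤ 4, msReqSlot X μ ν R λ₃ λ₄ j ≤ Q.CE·G.S 1·R.Gfr j`. -/
theorem msPieceSlotL_le {G : GeoConsts} {Q : EngConsts} {R : RenConsts} {X U c Λ₃ Λ₄ lam3 lam4 : ℝ}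
    {σ ε : ℕ → ℕ → ℝ} {μ ν : ℕ → ℝ} {n₀ m : ℕ}
    (hR : ∀ j, 0 ≤ R.Gfr j) (hU : 0 < U) (hU1 : U ≤ 1) (hn₀ : 1 ≤ n₀) (hm : n₀ + 1 ≤ m) (hX : 0 ≤ X)
    (hlam3 : 0 ≤ lam3) (hlam4 : 0 ≤ lam4) (hCE : 0 ≤ Q.CE) (hS1' : 0 ≤ Q.S' 1) (hμ : ∀ i, 0 ≤ μ i) (hν : ∀ i, 0 ≤ ν i)
    (hA0 : 0 ≤ msA R c U) (hA20 : msA R c U ≤ 1 / 20) (hd : klCurveD ≤ msDt - 2 * msA R c U)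
    (hΛ₃0 : 0 ≤ Λ₃) (hΛ₃ : Λ₃ ≤ lam3 * R.Gfr 1 * U ^ 2 * (4 : ℝ) ^ n₀)
    (hΛ₄0 : 0 ≤ Λ₄) (hΛ₄ : Λ₄ ≤ lam4 * R.Gfr 1 * U ^ 2 * ((4 : ℝ) ^ n₀) ^ 2)
    (hσ0 : ∀ k i, 0 ≤ σ k i)
    (hs1 : σ (m - n₀ - 1) 1 ≤ 4 * μ 1 * U ^ 2 / ((4 : ℝ) ^ n₀)) (hs2 : σ (m - n₀ - 1) 2 ≤ μ 2 * U ^ 2)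
    (hs3 : σ (m - n₀ - 1) 3 ≤ μ 3 * U ^ 2 * ((4 : ℝ) ^ n₀) / 4) (hs4 : σ (m - n₀ - 1) 4 ≤ μ 4 * U ^ 2 * ((4 : ℝ) ^ n₀) ^ 2 / 16) (hs5 : σ (m - n₀ - 1) 5 ≤ μ 5 * U ^ 2 * ((4 : ℝ) ^ n₀) ^ 3 / 64)
    (hε0 : ∀ m i, 0 ≤ ε m i)
    (he0 : ε m 0 ≤ ν 0 * U ^ 2 / ((4 : ℝ) ^ n₀) * (R.Gfr 0 * U / ((4 : ℝ) ^ m) ^ 2)) (he1 : ε m 1 ≤ ν 1 * U ^ 2 / ((4 : ℝ) ^ n₀) * (R.Gfr 1 * U ^ 2 / ((4 : ℝ) ^ m))) (he2 : ε m 2 ≤ ν 2 * U ^ 2 / ((4 : ℝ) ^ n₀) * (R.Gfr 2 * U ^ 2))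
    (he3 : ε m 3 ≤ ν 3 * U ^ 2 / ((4 : ℝ) ^ n₀) * (R.Gfr 3 * U ^ 2 * ((4 : ℝ) ^ m))) (he4 : ε m 4 ≤ ν 4 * U ^ 2 / ((4 : ℝ) ^ n₀) * (R.Gfr 4 * U ^ 2 * ((4 : ℝ) ^ m) ^ 2))
    (hfit : ∀ j ≤ 4, msReqSlot X μ ν R lam3 lam4 j ≤ Q.CE * G.S 1 * R.Gfr j) :
    ∀ j ≤ 4, msPieceSlotL X σ ε R c U (4 ^ n₀) n₀ Λ₃ Λ₄ m j ≤ msBarQ G Q U n₀ * (R.Gfr j * uPow j U * (4 : ℝ) ^ (((j : ℤ) - 2) * m)) := by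
  intro j hj
  interval_cases j
  · exact msPieceSlotL_le_zero hR hU hU1 hn₀ hm hX hCE hS1' hμ hν hA0 hd hΛ₃0 hΛ₄0 hσ0 hs1 hε0 he0 (hfit 0 (by norm_num))
  · exact msPieceSlotL_le_one hR hU hU1 hn₀ hm hX hCE hS1' hμ hν hA0 hA20 hd hΛ₃0 hΛ₄0 hσ0 hs1 hs2 hε0 he1 (hfit 1 (by norm_num))
  · exact msPieceSlotL_le_two hR hU hU1 hn₀ hm hX hlam3 hCE hS1' hμ hν hA0 hA20 hd hΛ₃0 hΛ₃ hΛ₄0 hσ0 hs1 hs2 hs3 hε0 he1 he2 (hfit 2 (by norm_num))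
  · exact msPieceSlotL_le_three hR hU hU1 hn₀ hm hX hlam3 hlam4 hCE hS1' hμ hν hA0 hA20 hd hΛ₃0 hΛ₃ hΛ₄0 hΛ₄ hσ0 hs1 hs2 hs3 hs4 hε0 he1 he2 he3 (hfit 3 (by norm_num))
  · exact msPieceSlotL_le_four hR hU hU1 hn₀ hm hX hlam3 hlam4 hCE hS1' hμ hν hA0 hA20 hd hΛ₃0 hΛ₃ hΛ₄0 hΛ₄ hσ0 hs1 hs2 hs3 hs4 hs5 hε0 he1 he2 he3 he4 (hfit 4 (by norm_num))

set_option maxRecDepth 8000 in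
/-- **(E3a-MS) BASE FITS ON THE TREE, all orders `j ≤ 4`** — the literal `hfit_n` input of the Λ-parametric suppliers, from the regime, the Λ-shapes,
the base-frame increment profile written out, and `∀ j ≤ 4, msReqBase0 X μ j ≤ G.S j/2 ∧ U·msReqBase1 X μ R λ₃ λ₄ j ≤ G.S j/2`. -/
theorem msPieceBaseL_le {G : GeoConsts} {Q : EngConsts} {R : RenConsts} {X U Λ₃ Λ₄ lam3 lam4 : ℝ}
    {σ : ℕ → ℕ → ℝ} {μ : ℕ → ℝ} {n₀ : ℕ}
    (hR : ∀ j, 0 ≤ R.Gfr j) (hU : 0 < U) (hU1 : U ≤ 1) (hn₀ : 1 ≤ n₀) (hX : 0 ≤ X)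
    (hlam3 : 0 ≤ lam3) (hlam4 : 0 ≤ lam4) (hS' : ∀ j, 0 ≤ Q.S' j) (hμ : ∀ i, 0 ≤ μ i)
    (hΛ₃0 : 0 ≤ Λ₃) (hΛ₃ : Λ₃ ≤ lam3 * R.Gfr 1 * U ^ 2 * (4 : ℝ) ^ n₀)
    (hΛ₄0 : 0 ≤ Λ₄) (hΛ₄ : Λ₄ ≤ lam4 * R.Gfr 1 * U ^ 2 * ((4 : ℝ) ^ n₀) ^ 2)
    (hσ0 : ∀ k i, 0 ≤ σ k i)
    (hs0 : σ 0 0 ≤ 16 * μ 0 * U ^ 2 / ((4 : ℝ) ^ n₀) ^ 2) (hs1 : σ 0 1 ≤ 4 * μ 1 * U ^ 2 / ((4 : ℝ) ^ n₀)) (hs2 : σ 0 2 ≤ μ 2 * U ^ 2)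
    (hs3 : σ 0 3 ≤ μ 3 * U ^ 2 * ((4 : ℝ) ^ n₀) / 4) (hs4 : σ 0 4 ≤ μ 4 * U ^ 2 * ((4 : ℝ) ^ n₀) ^ 2 / 16)
    (hfit0 : ∀ j ≤ 4, msReqBase0 X μ j ≤ G.S j / 2) (hfit1 : ∀ j ≤ 4, U * msReqBase1 X μ R lam3 lam4 j ≤ G.S j / 2) :
    ∀ j ≤ 4, msPieceBaseL X σ R U n₀ Λ₃ Λ₄ j ≤ twoLegBar G Q U j n₀ := by
  intro j hj
  interval_cases j
  · exact msPieceBaseL_le_zero hU hU1 hn₀ hX (hS' 0) hμ hσ0 hs0 (hfit0 0 (by norm_num)) (hfit1 0 (by norm_num))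
  · exact msPieceBaseL_le_one hU hU1 hn₀ hX (hS' 1) hμ hσ0 hs1 (hfit0 1 (by norm_num)) (hfit1 1 (by norm_num))
  · exact msPieceBaseL_le_two hU hU1 hn₀ hX (hS' 2) hμ hσ0 hs1 hs2 (hfit0 2 (by norm_num)) (hfit1 2 (by norm_num))
  · exact msPieceBaseL_le_three hR hU hU1 hn₀ hX hlam3 (hS' 3) hμ hΛ₃0 hΛ₃ hσ0 hs1 hs2 hs3 (hfit0 3 (by norm_num)) (hfit1 3 (by norm_num))
  · exact msPieceBaseL_le_four hR hU hU1 hn₀ hX hlam3 hlam4 (hS' 4) hμ hΛ₃0 hΛ₃ hΛ₄0 hΛ₄ hσ0 hs1 hs2 hs3 hs4 (hfit0 4 (by norm_num)) (hfit1 4 (by norm_num))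

end Summit.HubbardSuperconductivity.HubbardSuperconductivity.Theorems.KLRegimeSplit

end
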